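import Summits.KontsevichZagierPeriods.KontsevichZagierPeriods.Theorems.SoloBlindModulusChart

/-!
# Integrating the Legendre family over its modulus inside the rules, II: `∫₀¹ K(k) dk = 2G`

With the modulus chart `Φ` of part I (`SoloBlindModulusChart`) we perform the two moves of
Kontsevich–Zagier's rule (2)

  `[(0,1)², 2/(1+x²y²)] ≡ [(0,1)², dk dt/√((1-t²)(1-k²t²))]`        (`twoBetaBox_equiv_legKBox`),
  `[(0,1)², 2(1-x²y²)²/(1+x²y²)³] ≡ [(0,1)², √((1-k²t²)/(1-t²)) dk dt]`  (`eSrcBox_equiv_legEBox`),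

i.e. we integrate the complete elliptic integrals `K(k) = ∫₀¹ dt/√((1-t²)(1-k²t²))` and `E(k)`
over the modulus `k ∈ (0,1)` without leaving the rules.  By one move of rule (1b) the first image
is `2·[Bβ₂]`, `Bβ₂ = [(0,1)², 1/(1+x²y²)]` (value Catalan's constant `G`, `SoloBlindBetaBox`), so
`[(0,1)², dk dt/√((1-t²)(1-k²t²))] = 2·[Bβ₂]` in `Q = FormalRep/relations` (`mkQ_legKBox`) and,
by soundness, `∫₀¹∫₀¹ dk dt/√((1-t²)(1-k²t²)) = ∫₀¹ K(k) dk = 2G` (`legKBox_value`,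
`integral_integral_ellKf_eq`).  Finally `kz_modulus_catalan` records the conjecture of
Kontsevich–Zagier in the literal shape of the Statement for the pair (volume under the graph of
`1/√((1-t²)(1-k²t²))` over `(0,1)²`, `[(0,1)², 2/(1+x²y²)]`): two `ℚ`-rational representations of
`2G` — a number not known to be irrational — that are KZ-equivalent.

References: P. F. Byrd, M. D. Friedman, *Handbook of elliptic integrals* (1971), 615.01–615.14;
Y. Zhou, arXiv:1301.2584, §2; M. Kontsevich, D. Zagier, *Periods* (2001), §1.2.
-/

noncomputable section

namespace Summit.KontsevichZagierPeriods.KontsevichZagierPeriods.Theorems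

open Set MeasureTheory
open Literature.ModelTheory.ExponentialFields (IsSemialgebraic)
open MvPolynomial (aeval X C)
open Literature.NumberTheory.Transcendental
open Literature.NumberTheory.Transcendental.KZ

namespace SoloBlind

/-! ## The four representations -/

/-- **`[(0,1)², 2/(1+x²y²)]`** (value `2G`), the image side of the `K`-move; KZ-rational. -/
def twoBetaBox : IntegralRep 2 :=
  ratRep (kzOpenBox 2) (fun p => tW (p 0 * p 1)) 2 (1 + (X 0 * X 1) ^ 2)
    (isSemialgebraic_kzOpenBox 2)
    (fun p _ => by
      have : (0 : ℝ) < 1 + (p 0 * p 1) ^ 2 := by positivity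
      simpa using this.ne')
    (fun p _ => by simp [tW])
    (integrableOn_kzOpenBox_two_of_continuous
      ((continuous_const.div (by fun_prop) fun u : ℝ =>
        (by positivity : (0 : ℝ) < 1 + u ^ 2).ne' : Continuous tW).comp (by fun_prop)))

/-- **`[(0,1)², 2(1-x²y²)²/(1+x²y²)³]`** (value `G + 1/2`, part II), the image side of the
`E`-move; KZ-rational. -/
def eSrcBox : IntegralRep 2 :=
  ratRep (kzOpenBox 2) (fun p => tC (p 0 * p 1) ^ 2 * tW (p 0 * p 1))
    (2 * (1 - (X 0 * X 1) ^ 2) ^ 2) ((1 + (X 0 * X 1) ^ 2) ^ 3)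
    (isSemialgebraic_kzOpenBox 2)
    (fun p _ => by
      have : (0 : ℝ) < (1 + (p 0 * p 1) ^ 2) ^ 3 := by positivity
      simpa using this.ne')
    (fun p _ => by
      have : (1 : ℝ) + (p 0 * p 1) ^ 2 ≠ 0 := by positivity
      simp only [tC, tW, map_mul, map_pow, map_sub, map_add, map_one, map_ofNat,
        MvPolynomial.aeval_X]
      field_simp)
    (integrableOn_kzOpenBox_two_of_continuous
      ((((continuous_const.sub (continuous_pow 2)).div (by fun_prop) fun u : ℝ =>
          (by positivity : (0 : ℝ) < 1 + u ^ 2).ne' : Continuous tC).pow 2 |>.mul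
        (continuous_const.div (by fun_prop) fun u : ℝ =>
          (by positivity : (0 : ℝ) < 1 + u ^ 2).ne' : Continuous tW)).comp (by fun_prop)))

/-- `Kf(k, t) = 1/√((1-t²)(1-k²t²))` is `ℚ`-semialgebraic on the square. -/
theorem isSemialgebraicFunOn_ellKf_box :
    IsSemialgebraicFunOn ℚ (kzOpenBox 2) fun q => ellKf (q 0 ^ 2) (q 1) :=
  ((isSemialgebraicFunOn_aeval (isSemialgebraic_kzOpenBox 2)
    ((1 - X 1 ^ 2) * (1 - X 0 ^ 2 * X 1 ^ 2))).fun_sqrt.fun_inv).congr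
      fun q _ => by simp [ellKf, one_div]

/-- `Ef(k, t) = √((1-k²t²)/(1-t²))` is `ℚ`-semialgebraic on the square. -/
theorem isSemialgebraicFunOn_ellEf_box :
    IsSemialgebraicFunOn ℚ (kzOpenBox 2) fun q => ellEf (q 0 ^ 2) (q 1) := by
  have hS := isSemialgebraic_kzOpenBox 2
  exact (((isSemialgebraicFunOn_aeval hS (1 - X 0 ^ 2 * X 1 ^ 2)).fun_mul
    (isSemialgebraicFunOn_aeval hS (1 - X 1 ^ 2)).fun_inv).fun_sqrt).congr
      fun q _ => by simp [ellEf, div_eq_mul_inv]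

/-- **`[(0,1)², dk dt/√((1-t²)(1-k²t²))]`** ("`∫₀¹ K(k) dk`"; coordinates `q 0 = k`, `q 1 = t`).
Absolute integrability is transported along the modulus chart from the bounded form `W(xy)`. -/
def legKBox : IntegralRep 2 where
  domain := kzOpenBox 2
  integrand q := ellKf (q 0 ^ 2) (q 1)
  isSemialgebraic_domain := isSemialgebraic_kzOpenBox 2
  isSemialgebraicFunOn_integrand := isSemialgebraicFunOn_ellKf_box
  integrableOn := by
    have h := (integrableOn_iff_of_chart (f := fun p => tW (p 0 * p 1))
      (g := fun q => ellKf (q 0 ^ 2) (q 1)) (J := modJac) (measurableSet_kzOpenBox 2)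
      (fun p _ => hasFDerivAt_modChart p) injOn_modChart (fun _ hp => abs_det_modDeriv hp)
      (fun _ hp => tW_eq_ellKf_modChart_mul hp)).mpr twoBetaBox.integrableOn
    rwa [image_modChart] at h

/-- **`[(0,1)², √((1-k²t²)/(1-t²)) dk dt]`** ("`∫₀¹ E(k) dk`"). -/
def legEBox : IntegralRep 2 where
  domain := kzOpenBox 2
  integrand q := ellEf (q 0 ^ 2) (q 1)
  isSemialgebraic_domain := isSemialgebraic_kzOpenBox 2
  isSemialgebraicFunOn_integrand := isSemialgebraicFunOn_ellEf_box
  integrableOn := by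
    have h := (integrableOn_iff_of_chart (f := fun p => tC (p 0 * p 1) ^ 2 * tW (p 0 * p 1))
      (g := fun q => ellEf (q 0 ^ 2) (q 1)) (J := modJac) (measurableSet_kzOpenBox 2)
      (fun p _ => hasFDerivAt_modChart p) injOn_modChart (fun _ hp => abs_det_modDeriv hp)
      (fun _ hp => tC_sq_mul_tW_eq_ellEf_modChart_mul hp)).mpr eSrcBox.integrableOn
    rwa [image_modChart] at h

/-- `twoBetaBox` has KZ's literal rational shape. -/
theorem isRational_twoBetaBox : twoBetaBox.IsRational := isRational_ratRep

/-- `eSrcBox` has KZ's literal rational shape. -/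
theorem isRational_eSrcBox : eSrcBox.IsRational := isRational_ratRep

/-! ## The two moves of rule (2) -/

/-- **Rule (2) along the modulus chart, `K`: `[(0,1)², W(xy)] ≡ [(0,1)², Kf]`.** -/
theorem twoBetaBox_equiv_legKBox : Equivalent twoBetaBox legKBox :=
  equivalent_of_chart (f := fun p => tW (p 0 * p 1)) (g := fun q => ellKf (q 0 ^ 2) (q 1))
    (J := modJac) isSemialgebraicMapOn_modChart (fun p _ => hasFDerivAt_modChart p)
    injOn_modChart image_modChart (fun _ hp => abs_det_modDeriv hp)
    (fun _ hp => tW_eq_ellKf_modChart_mul hp) rfl (fun _ _ => rfl) rfl (fun _ _ => rfl)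

/-- **Rule (2) along the modulus chart, `E`: `[(0,1)², C(xy)²W(xy)] ≡ [(0,1)², Ef]`.** -/
theorem eSrcBox_equiv_legEBox : Equivalent eSrcBox legEBox :=
  equivalent_of_chart (f := fun p => tC (p 0 * p 1) ^ 2 * tW (p 0 * p 1))
    (g := fun q => ellEf (q 0 ^ 2) (q 1)) (J := modJac) isSemialgebraicMapOn_modChart
    (fun p _ => hasFDerivAt_modChart p) injOn_modChart image_modChart
    (fun _ hp => abs_det_modDeriv hp) (fun _ hp => tC_sq_mul_tW_eq_ellEf_modChart_mul hp)
    rfl (fun _ _ => rfl) rfl (fun _ _ => rfl)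

/-! ## Classes and values: `∫₀¹ K(k) dk = 2G` inside the rules -/

/-- **Rule (1b): `[(0,1)², 2/(1+x²y²)] - [Bβ₂] - [Bβ₂]` is a relation.** -/
theorem twoBetaBox_sub_two_betaBoxRep :
    of twoBetaBox - of (betaBoxRep 2) - of (betaBoxRep 2) ∈ relations :=
  integrandAddRel_subset_relations ⟨2, twoBetaBox, betaBoxRep 2, betaBoxRep 2, rfl, rfl,
    fun p _ => by
      simp only [twoBetaBox, betaBoxRep, ratRep_integrand, Pi.add_apply, Fin.prod_univ_two, tW]
      ring, rfl⟩

/-- `[(0,1)², 2/(1+x²y²)] = 2·[Bβ₂]` in `Q`. -/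
theorem mkQ_twoBetaBox : mkQ (of twoBetaBox) = 2 • mkQ (of (betaBoxRep 2)) := by
  rw [← map_nsmul, mkQ_eq_mkQ_iff, two_nsmul, ← sub_sub]
  exact twoBetaBox_sub_two_betaBoxRep

/-- **`[(0,1)², dk dt/√((1-t²)(1-k²t²))] = 2·[Bβ₂]` in `Q`.** -/
theorem mkQ_legKBox : mkQ (of legKBox) = 2 • mkQ (of (betaBoxRep 2)) := by
  rw [← mkQ_twoBetaBox]
  exact (mkQ_eq_mkQ_iff.2 twoBetaBox_equiv_legKBox).symm

/-- `∫_{(0,1)²} 2/(1+x²y²) = 2G`. -/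
theorem twoBetaBox_value : twoBetaBox.value = 2 * catalanConstant := by
  rw [← betaBoxRep_value_two, betaBoxRep_value, ← integral_const_mul]
  show ∫ p in kzOpenBox 2, tW (p 0 * p 1) = _
  refine setIntegral_congr_fun (measurableSet_kzOpenBox 2) fun p _ => ?_
  simp only [tW, Fin.prod_univ_two]
  ring

/-- **`∫_{(0,1)²} dk dt/√((1-t²)(1-k²t²)) = 2G`** (soundness of the moves). -/
theorem legKBox_value : legKBox.value = 2 * catalanConstant := by
  rw [← twoBetaBox_value]
  exact (Equivalent.value_eq_holds twoBetaBox_equiv_legKBox).symm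

/-- `∫_{(0,1)²} √((1-k²t²)/(1-t²)) = ∫_{(0,1)²} 2(1-x²y²)²/(1+x²y²)³`. -/
theorem legEBox_value : legEBox.value = eSrcBox.value :=
  (Equivalent.value_eq_holds eSrcBox_equiv_legEBox).symm

/-- **Fubini on the open square**: for an integrable `f(q 0, q 1)`,
`∫_{(0,1)²} f = ∫₀¹ (∫₀¹ f(k, t) dt) dk`. -/
theorem setIntegral_kzOpenBox_two (f : ℝ → ℝ → ℝ)
    (hf : IntegrableOn (fun q : Fin 2 → ℝ => f (q 0) (q 1)) (kzOpenBox 2)) :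
    ∫ q in kzOpenBox 2, f (q 0) (q 1) = ∫ k in Ioo (0 : ℝ) 1, ∫ t in Ioo (0 : ℝ) 1, f k t := by
  have he := volume_preserving_finTwoArrow ℝ
  have hemb := (MeasurableEquiv.finTwoArrow (α := ℝ)).measurableEmbedding
  have hbox : kzOpenBox 2 =
      (MeasurableEquiv.finTwoArrow (α := ℝ)) ⁻¹' (Ioo (0 : ℝ) 1 ×ˢ Ioo (0 : ℝ) 1) := by
    ext q
    simp [kzOpenBox, Fin.forall_fin_two]
  have hcomp : (fun q : Fin 2 → ℝ => f (q 0) (q 1)) =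
      (fun z : ℝ × ℝ => f z.1 z.2) ∘ (MeasurableEquiv.finTwoArrow (α := ℝ)) := by
    funext q
    simp
  have hint : IntegrableOn (fun z : ℝ × ℝ => f z.1 z.2) (Ioo (0 : ℝ) 1 ×ˢ Ioo (0 : ℝ) 1)
      ((volume : Measure ℝ).prod volume) := by
    rw [hbox, hcomp, he.integrableOn_comp_preimage hemb] at hf
    rwa [← Measure.volume_eq_prod]
  calc ∫ q in kzOpenBox 2, f (q 0) (q 1)
      = ∫ q in (MeasurableEquiv.finTwoArrow (α := ℝ)) ⁻¹' (Ioo (0 : ℝ) 1 ×ˢ Ioo (0 : ℝ) 1),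
          (fun z : ℝ × ℝ => f z.1 z.2) (MeasurableEquiv.finTwoArrow (α := ℝ) q) := by
        rw [← hbox]
        rfl
    _ = ∫ z in Ioo (0 : ℝ) 1 ×ˢ Ioo (0 : ℝ) 1, f z.1 z.2 :=
        he.setIntegral_preimage_emb hemb (fun z : ℝ × ℝ => f z.1 z.2) _
    _ = ∫ k in Ioo (0 : ℝ) 1, ∫ t in Ioo (0 : ℝ) 1, f k t := by
        rw [Measure.volume_eq_prod, setIntegral_prod _ hint]

/-- **`∫₀¹ K(k) dk = 2G`** as an iterated integral: `∫₀¹ (∫₀¹ dt/√((1-t²)(1-k²t²))) dk = 2G`. -/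
theorem integral_integral_ellKf_eq :
    ∫ k in Ioo (0 : ℝ) 1, ∫ t in Ioo (0 : ℝ) 1, ellKf (k ^ 2) t = 2 * catalanConstant := by
  rw [← legKBox_value,
    ← setIntegral_kzOpenBox_two (fun k t => ellKf (k ^ 2) t) legKBox.integrableOn]
  rfl

/-! ## The conjecture for this pair, in the literal form of the Statement -/

/-- **Kontsevich–Zagier for `∫₀¹ K(k) dk = 2G`.** The volume-under-the-graph representation of
`[(0,1)², dk dt/√((1-t²)(1-k²t²))]` (dimension `3`) and `[(0,1)², 2/(1+x²y²)]` are two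
`ℚ`-rational representations with the same value, `2G`, and they are KZ-equivalent — an instance
of the Statement for a number not known to be irrational. -/
theorem kz_modulus_catalan :
    (legKBox.graphRep
        Literature.ModelTheory.ExponentialFields.tarski_seidenberg_real_holds).IsRational ∧
      twoBetaBox.IsRational ∧
      (legKBox.graphRep
          Literature.ModelTheory.ExponentialFields.tarski_seidenberg_real_holds).value =
        twoBetaBox.value ∧
      Equivalent (legKBox.graphRep
        Literature.ModelTheory.ExponentialFields.tarski_seidenberg_real_holds) twoBetaBox :=
  ⟨IntegralRep.isRational_graphRep _ _, isRational_twoBetaBox,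
    by rw [← Equivalent.value_eq_holds (legKBox.equivalent_graphRep _), legKBox_value,
      twoBetaBox_value],
    ((legKBox.equivalent_graphRep _).symm.trans twoBetaBox_equiv_legKBox.symm)⟩

end SoloBlind

end Summit.KontsevichZagierPeriods.KontsevichZagierPeriods.Theorems
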